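import Summits.BirchSwinnertonDyer.Rank1Residual.X1.PadicSigmaThreeUniversalRingQ
import Literature.NumberTheory.EllipticCurves.PadicSigmaIsogenyCriterionProofs
import HarnessLib

/-!
# Blakestad–Grant's Thm 1 over `R̂₃`: `exp ∫ζ̃ω ∈ R̂₃⟦t⟧` for the universal ordinary `a₂`-curve from the
# data of a Frobenius `3`-isogeny (module M4b of the x1a design for the Mazur–Tate sigma function at
# `p = 3`)

HONEST FRAMING (cell `b2b-bsdres`, run/shared/lean/b2b/bsd-rank1-residual/, verbatim in every file):
the goal of the cell is to DELETE the COMBINATION-SHAPED residual classes of the Birch–Swinnerton-Dyer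
formula for ALL analytic-rank `≤ 1` elliptic curves over `ℚ` — "full BSD formula for every rank `≤ 1`
curve in class `C`" assembled STRICTLY from published theorems — so that the rank-`≤ 1` remainder
becomes exactly the CONSTRUCTION-SHAPED classes, which are TYPED (missing-input `Prop`s), NOT
attempted. This is not "finishing BSD". CLASS-OWNERS.md row "X1 (r = 1)": research route; NO CLAIM
BEYOND STATED CLASSES; nothing is booked by this file; no preprint enters; no named fact.

Unit `b2b-bsdres-x1a` (X1 prover A, gen 20). WHAT. The tree's per-prime theorem
`UniversalOrdinary.coeff_exp_sigmaExpArg_universalCurve_mem[']` (Blakestad–Grant's Thm 1 over `R̂` from the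
data of a Frobenius `p`-isogeny: Thm 2 transport, Prop. 13(a) `zetaTilde_isogeny_rel_of_formalXReg_rel`,
then Dwork's lemma `coeff_exp_sigmaExpArg_mem_of_isogeny` over `K = R̂[1/p]`), repeated for the universal
ordinary `a₂`-curve `𝓔` over `R̂₃ = ℤ[Y, A₄, A₆][1/Y]^₃` (`X1/PadicSigmaThreeUniversal*.lean`) with an
ARBITRARY endomorphism `α` of `R̂₃` reducing to the Frobenius (`α x ≡ x³ (mod 3)`) in place of
`frobeniusLift`:
* `coeff_exp_sigmaExpArg_universalCurve_mem` — from `T ∈ R̂₃⟦t⟧` (`T ≡ t³`), `u` (`u(0) = 1`, `[t]u = 0`,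
  `u ≡ 1`), `π, T₀ ∈ R̂₃` with `ω'(T)dT = πω` for `𝓔' = α_*𝓔` and the Prop. 13 hypothesis in `ρ`-form
  `(π²ρ'(T) - 3ρ + T₀)u² = uD²u - (Du)²`, every even zeta series `Λ` of `𝓔` has `exp(∫ζ̃ω) ∈ R̂₃⟦t⟧`;
* `coeff_exp_sigmaExpArg_universalCurve_mem'` — the same with the two identities required only over
  `K₃` (`π, T₀ ∈ K₃`; they descend: `π = [t¹]T`, `T₀ = [t⁰]` of an `R̂₃`-series).
The data are supplied by `X1/PadicSigmaThreeFormalIsogenyChart.lean` at the universal chart with `α` the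
Frobenius lift `(Y, A₄, A₆) ↦ (Y', a₄', a₆')` (module M4c).

References: C. Blakestad, D. Grant, J. Number Theory 249 (2023) 348–376, Thm 1, Thm 2, Prop. 13, Cor. 6(c)
[BlakestadGrant2023]; tree `PadicSigmaIsogenyCriterionProofs.lean` (same proof for Blakestad–Grant's `R̂`).

Pure proof file: no definitions, no named facts, no `sorry`.
-/

noncomputable section

open PowerSeries Literature.NumberTheory.EllipticCurves Literature.RingTheory.FormalGroups

namespace Summit.BirchSwinnertonDyer.Rank1Residual.X1.PadicSigmaThree.Universal

open WeierstrassCurve Literature.RingTheory.AdicTopology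

/-- From the `(3)`-congruence form to the `3·b` form along `R̂₃ → K₃`. [folklore] -/
theorem exists_mem_intSubring_of_sub_mem_span {x δ : completeRing} (h : x - δ ∈ Ideal.span {(3 : completeRing)}) :
    ∃ b ∈ intSubring, algebraMap completeRing completeRingQ x = algebraMap completeRing completeRingQ δ + 3 * b := by
  obtain ⟨b, hb⟩ := Ideal.mem_span_singleton'.mp h
  refine ⟨algebraMap _ _ b, ⟨b, rfl⟩, ?_⟩
  rw [← map_ofNat (algebraMap completeRing completeRingQ) 3, ← map_mul, ← map_add, mul_comm, hb, add_sub_cancel]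

/-- **Thm 1 over `R̂₃` from `R̂₃`-valued isogeny data.** Let `α` be an endomorphism of `R̂₃` with
`α(x) ≡ x³ (mod 3)`, `𝓔' = α_*𝓔`; `T ∈ tR̂₃⟦t⟧` with `T ≡ t³ (mod 3)` and `ω'(T)dT = πω`; `u = 1 + O(t²)`
with `u ≡ 1 (mod 3)`; `π, T₀ ∈ R̂₃` with `(π²ρ'(T) - 3ρ + T₀)u² = uD²u - (Du)²`. Then for every even zeta
series `Λ` of `𝓔` (constant `β`), `exp(∫ζ̃ω)` has coefficients in `R̂₃ ⊆ K₃`.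
[cite: BlakestadGrant2023, Thm. 1] -/
theorem coeff_exp_sigmaExpArg_universalCurve_mem (α : completeRing →+* completeRing)
    (hα : ∀ x, α x - x ^ 3 ∈ Ideal.span {(3 : completeRing)})
    {T u : PowerSeries completeRing} {π T₀ : completeRing}
    (hT0 : constantCoeff T = 0)
    (hT : ∀ n, coeff n T - (if n = 3 then 1 else 0) ∈ Ideal.span {(3 : completeRing)})
    (hu0 : constantCoeff u = 1) (hu1 : coeff 1 u = 0)
    (hu : ∀ n, coeff (n + 1) u ∈ Ideal.span {(3 : completeRing)})
    (hTω : (universalCurve.map α).formalInvDiff.subst T * d⁄dX completeRing T = C π * universalCurve.formalInvDiff)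
    (hB : (C (π ^ 2) * ((universalCurve.map α).formalXReg).subst T -
        (3 : PowerSeries completeRing) * universalCurve.formalXReg + C T₀) * u ^ 2 =
      logDeriv₂Num universalCurve.formalInvariantDerivation u)
    {β : completeRing} {Λ : PowerSeries completeRing} (h0 : constantCoeff Λ = 1)
    (hev : rescale (-1 : completeRing) Λ = Λ)
    (hΛ : X * d⁄dX completeRing Λ - Λ = -((universalCurve.formalXMulSq - C β * X ^ 2) * universalCurve.formalInvDiff))
    (n : ℕ) :
    coeff n ((exp completeRingQ).subst ((universalCurve.map (algebraMap completeRing completeRingQ)).sigmaExpArg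
      (PowerSeries.map (algebraMap completeRing completeRingQ) Λ))) ∈ intSubring := by
  set E := universalCurve with hE
  -- Prop. 13(a) over `R̂₃`
  have hsep : ∀ c : completeRing, (∀ n : ℕ, c ∈ Ideal.span {((3 : ℕ) : completeRing) ^ (n + 1)}) → c = 0 :=
    fun c hc => eq_zero_of_forall_mem_pow c hc
  have hw := isUnit_coeff_formalInvDiff_universalCurve_pow
  have hΛ' := E.map_zetaSeries_eq α hΛ
  have hΛ'0 : constantCoeff (PowerSeries.map α Λ) = 1 := by
    rw [← coeff_zero_eq_constantCoeff_apply, coeff_map, coeff_zero_eq_constantCoeff_apply, h0, map_one]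
  have hΛ1 : coeff 1 Λ = 0 := coeff_eq_zero_of_rescale_neg_one_eq_self hev odd_one
  have hζ0 : constantCoeff (E.zetaTilde Λ) = 0 := by
    rw [WeierstrassCurve.constantCoeff_zetaTilde, WeierstrassCurve.coeff_one_formalEta, hΛ1, hE]
    change (0 : completeRing) - -0 = 0
    rw [neg_zero, sub_zero]
  have hζ'0 : constantCoeff ((E.map α).zetaTilde (PowerSeries.map α Λ)) = 0 := by
    rw [WeierstrassCurve.constantCoeff_zetaTilde, WeierstrassCurve.coeff_one_formalEta, coeff_map, hΛ1, map_zero,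
      WeierstrassCurve.map_a₁, hE]
    change (0 : completeRing) - -(α 0) = 0
    rw [map_zero, neg_zero, sub_zero]
  have hB3 : (C (π ^ 2) * ((E.map α).formalXReg).subst T - ((3 : ℕ) : PowerSeries completeRing) * E.formalXReg +
      C T₀) * u ^ 2 = logDeriv₂Num E.formalInvariantDerivation u := by
    simpa only [Nat.cast_ofNat] using hB
  have hQ := E.zetaTilde_isogeny_rel_of_formalXReg_rel 3 hsep hw h0 hΛ hΛ'0 hΛ' hT0 hTω hu0 hu1 hζ0 hζ'0 hB3
  -- base change to `K₃`
  set ι := algebraMap completeRing completeRingQ with hι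
  set αK := extendQ α with hαK
  have hcomp : ι.comp α = αK.comp ι := RingHom.ext fun x => (extendQ_algebraMap α x).symm
  have hcurve : (E.map α).map ι = (E.map ι).map αK := by rw [WeierstrassCurve.map_map, WeierstrassCurve.map_map, hcomp]
  have hΛmap : PowerSeries.map ι (PowerSeries.map α Λ) = PowerSeries.map αK (PowerSeries.map ι Λ) := by
    rw [map_map_apply, map_map_apply, hcomp]
  have hsT : HasSubst T := HasSubst.of_constantCoeff_zero' hT0
  have hT0' : constantCoeff (PowerSeries.map ι T) = 0 := by
    rw [← coeff_zero_eq_constantCoeff_apply, coeff_map, coeff_zero_eq_constantCoeff_apply, hT0, map_zero]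
  have hTω' : ((E.map ι).map αK).formalInvDiff.subst (PowerSeries.map ι T) *
      d⁄dX completeRingQ (PowerSeries.map ι T) = C (ι π) * (E.map ι).formalInvDiff := by
    have h := congrArg (PowerSeries.map ι) hTω
    rw [map_mul, map_subst_apply hsT, ← derivative_map, (E.map α).map_formalInvDiff ι, hcurve,
      map_mul, map_C, E.map_formalInvDiff ι] at h
    exact h
  have hQ' : (((3 : ℕ) : PowerSeries completeRingQ) * (E.map ι).zetaTilde (PowerSeries.map ι Λ) -
      C (ι π) * (((E.map ι).map αK).zetaTilde (PowerSeries.map αK (PowerSeries.map ι Λ))).subst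
        (PowerSeries.map ι T)) * PowerSeries.map ι u =
      (E.map ι).formalInvariantDerivation (PowerSeries.map ι u) := by
    have h := congrArg (PowerSeries.map ι) hQ
    rw [map_mul, map_sub, map_mul, map_mul, map_natCast, E.map_zetaTilde ι, map_C,
      map_subst_apply hsT, (E.map α).map_zetaTilde ι, hcurve, hΛmap,
      WeierstrassCurve.formalInvariantDerivation_apply, map_mul, E.map_formalEta ι, ← derivative_map,
      ← WeierstrassCurve.formalInvariantDerivation_apply] at h
    exact h
  -- Thm 1 by Dwork's lemma over `K₃`
  refine (E.map ι).coeff_exp_sigmaExpArg_mem_of_isogeny 3 intSubring αK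
    exists_natCast_pow_mul_mem_intSubring (fun r hr => extendQ_mem_intSubring α hr)
    (fun r hr => exists_extendQ_eq_pow_add' α hα hr)
    (WeierstrassCurve.constantCoeff_map_eq_one ι h0) ?_ hT0' ?_ hTω'
    (WeierstrassCurve.constantCoeff_map_eq_one ι hu0) ?_ hQ' n
  · rw [← E.map_zetaTilde ι, ← coeff_zero_eq_constantCoeff_apply, coeff_map]
    exact ⟨_, rfl⟩
  · intro n
    obtain ⟨b, hb, h⟩ := exists_mem_intSubring_of_sub_mem_span (hT n)
    refine ⟨b, hb, ?_⟩
    rw [← hι] at h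
    rw [coeff_map, h, Nat.cast_ofNat (R := completeRingQ)]
    split_ifs <;> simp
  · intro n
    obtain ⟨b, hb, h⟩ := exists_mem_intSubring_of_sub_mem_span
      (show coeff (n + 1) u - 0 ∈ Ideal.span {(3 : completeRing)} by rw [sub_zero]; exact hu n)
    rw [← hι] at h
    exact ⟨b, hb, by rw [coeff_map, h, map_zero, zero_add, Nat.cast_ofNat (R := completeRingQ)]⟩

/-- **The same with the two identities checked over `K₃ = R̂₃[1/3]`** (`π, T₀ ∈ K₃` arbitrary): both
descend (`π = [t¹]T`, `T₀ = [t⁰]` of an `R̂₃`-series) because `R̂₃ → K₃` is injective.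
[cite: BlakestadGrant2023, Thm. 1] -/
theorem coeff_exp_sigmaExpArg_universalCurve_mem' (α : completeRing →+* completeRing)
    (hα : ∀ x, α x - x ^ 3 ∈ Ideal.span {(3 : completeRing)})
    {T u : PowerSeries completeRing} {π T₀ : completeRingQ}
    (hT0 : constantCoeff T = 0)
    (hT : ∀ n, coeff n T - (if n = 3 then 1 else 0) ∈ Ideal.span {(3 : completeRing)})
    (hu0 : constantCoeff u = 1) (hu1 : coeff 1 u = 0)
    (hu : ∀ n, coeff (n + 1) u ∈ Ideal.span {(3 : completeRing)})
    (hTω : ((universalCurve.map α).map (algebraMap completeRing completeRingQ)).formalInvDiff.subst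
        (PowerSeries.map (algebraMap completeRing completeRingQ) T) *
      d⁄dX completeRingQ (PowerSeries.map (algebraMap completeRing completeRingQ) T) =
      C π * (universalCurve.map (algebraMap completeRing completeRingQ)).formalInvDiff)
    (hB : (C (π ^ 2) * (((universalCurve.map α).map (algebraMap completeRing completeRingQ)).formalXReg).subst
        (PowerSeries.map (algebraMap completeRing completeRingQ) T) -
        (3 : PowerSeries completeRingQ) * (universalCurve.map (algebraMap completeRing completeRingQ)).formalXReg +
        C T₀) * PowerSeries.map (algebraMap completeRing completeRingQ) u ^ 2 =
      logDeriv₂Num (universalCurve.map (algebraMap completeRing completeRingQ)).formalInvariantDerivation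
        (PowerSeries.map (algebraMap completeRing completeRingQ) u))
    {β : completeRing} {Λ : PowerSeries completeRing} (h0 : constantCoeff Λ = 1)
    (hev : rescale (-1 : completeRing) Λ = Λ)
    (hΛ : X * d⁄dX completeRing Λ - Λ = -((universalCurve.formalXMulSq - C β * X ^ 2) * universalCurve.formalInvDiff))
    (n : ℕ) :
    coeff n ((exp completeRingQ).subst ((universalCurve.map (algebraMap completeRing completeRingQ)).sigmaExpArg
      (PowerSeries.map (algebraMap completeRing completeRingQ) Λ))) ∈ intSubring := by
  set ι := algebraMap completeRing completeRingQ with hι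
  set E := universalCurve with hE
  set E' := universalCurve.map α with hE'
  have hinj := powerSeries_map_algebraMap_injective
  have hsT : HasSubst T := HasSubst.of_constantCoeff_zero' hT0
  have hT0' : constantCoeff (PowerSeries.map ι T) = 0 := by
    rw [← coeff_zero_eq_constantCoeff_apply, coeff_map, coeff_zero_eq_constantCoeff_apply, hT0, map_zero]
  -- `π = ι([t¹]T)`
  have hπ : π = ι (coeff 1 T) := by
    have h := congrArg constantCoeff hTω
    rw [map_mul, Literature.RingTheory.FormalGroups.constantCoeff_subst_of_constantCoeff_eq_zero hT0',
      WeierstrassCurve.constantCoeff_formalInvDiff,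
      one_mul, ← coeff_zero_eq_constantCoeff_apply, coeff_derivative, zero_add, Nat.cast_zero, zero_add,
      mul_one, coeff_map, map_mul, WeierstrassCurve.constantCoeff_formalInvDiff, mul_one, constantCoeff_C] at h
    exact h.symm
  have hTωR : E'.formalInvDiff.subst T * d⁄dX completeRing T = C (coeff 1 T) * E.formalInvDiff := by
    apply hinj
    rw [map_mul, map_subst_apply hsT, E'.map_formalInvDiff ι, ← derivative_map, map_mul, map_C, E.map_formalInvDiff ι, ← hπ]
    exact hTω
  set G : PowerSeries completeRing := logDeriv₂Num E.formalInvariantDerivation u -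
    (C (coeff 1 T ^ 2) * (E'.formalXReg).subst T - (3 : PowerSeries completeRing) * E.formalXReg) * u ^ 2 with hG
  have hmapD : ∀ f : PowerSeries completeRing, PowerSeries.map ι (E.formalInvariantDerivation f) =
      (E.map ι).formalInvariantDerivation (PowerSeries.map ι f) := fun f => by
    rw [WeierstrassCurve.formalInvariantDerivation_apply, WeierstrassCurve.formalInvariantDerivation_apply,
      map_mul, E.map_formalEta ι, derivative_map]
  have hmapL : PowerSeries.map ι (logDeriv₂Num E.formalInvariantDerivation u) =
      logDeriv₂Num (E.map ι).formalInvariantDerivation (PowerSeries.map ι u) := by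
    simp only [logDeriv₂Num_def, map_sub, map_mul, map_pow, hmapD]
  have hGmap : PowerSeries.map ι G = C T₀ * PowerSeries.map ι u ^ 2 := by
    have hB' := hB
    simp only [map_pow] at hB'
    rw [hG]
    simp only [map_sub, map_mul, map_pow, map_C, map_ofNat, hmapL, map_subst_apply hsT, E'.map_formalXReg ι, E.map_formalXReg ι]
    rw [← hπ]
    linear_combination -hB'
  have hT₀ : T₀ = ι (constantCoeff G) := by
    have h := congrArg constantCoeff hGmap
    rw [← coeff_zero_eq_constantCoeff_apply, coeff_map, coeff_zero_eq_constantCoeff_apply, map_mul, map_pow,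
      ← coeff_zero_eq_constantCoeff_apply (PowerSeries.map ι u), coeff_map, coeff_zero_eq_constantCoeff_apply,
      hu0, map_one, one_pow, mul_one, constantCoeff_C] at h
    exact h.symm
  have hBR : (C (coeff 1 T ^ 2) * (E'.formalXReg).subst T - (3 : PowerSeries completeRing) * E.formalXReg +
      C (constantCoeff G)) * u ^ 2 = logDeriv₂Num E.formalInvariantDerivation u := by
    have hGC : G = C (constantCoeff G) * u ^ 2 := by
      apply hinj
      rw [hGmap, map_mul, map_C, map_pow, ← hT₀]
    have hG' := hG
    rw [hGC] at hG'
    linear_combination hG'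
  exact coeff_exp_sigmaExpArg_universalCurve_mem α hα hT0 hT hu0 hu1 hu hTωR hBR h0 hev hΛ n

end Summit.BirchSwinnertonDyer.Rank1Residual.X1.PadicSigmaThree.Universal

end
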